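import Summits.QuantumFields.YangMills.Theorems.BalabanLadderUVSeamRecClassicalResponseThermalFloorSplit
import HarnessLib

/-!
# Crux `UVSeamRec` (stmt-QuantumFields-20043): the classical split with the COLD-WALL REFERENCE —
# (split-cl) = tempered-d1's Dirichlet rate law (DR) + a cold-wall-referenced split whose onset is the renormalisation-group content

Helper file (`--supports stmt-QuantumFields-20043`) of the LEAD seat `ym-spine-20043-p1` (gen 10); sequel of `…ClassicalResponseSemiclassical`
(p590468: the fixed-scale split with the TRIVIAL reference `p ≡ N`) and `…ClassicalResponseThermalFloorSplit` (p592745/p592923/p593536: with `p ≡ N`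
the onset is forced to grow like `R⁴`, because the cold-wall kernel itself keeps a thermal deficit `≥ 6/(24β+3)`).

THE REPAIR.  Reference the split to the COLD-WALL KERNEL MEAN `kerE^{𝟙}_{β,R}(plane q x)` (the identity exterior; translation invariant in `x`, but
`R`-dependent) instead of the constant `N`:
* §1 **`pureSplit_fixedScale_coldWall`** (every compact `G`, every lattice representation): for every `R ≥ 1`, `q`, `x` and `C_s, C₁, A₀ > 0` there is
  `β₁` with `(R⁴/C₁)|kerE^η_β(plane q x) − kerE^𝟙_β(plane q x)| ≤ A₀ + carrierCl r C_s 1 β R q x η` for ALL `β ≥ β₁` and ALL `η` — the same Laplace /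
  carrier dichotomy as p590468, but now BOTH kernel deficits lie in `[0, 2t]` on the low-response set (the identity exterior has zero response), so the
  thermal `Θ(1/β)` offsets CANCEL: part 3's obstruction `onset_ge_of_split_const_at` does not apply to this version.
* §2 **`pureSplitCl_of_dirichletRate_and_coldWallSplit`** — the located DECOMPOSITION of tempered-d1's flag-free split: `PureSplitCl C_s C₁ (A₁ + A₂) β₀ ℓ₁ p`
  FOLLOWS from (a) tempered-d1's exterior-free Dirichlet rate law `DirichletRate C₁ A₁ β₀ ℓ₁ p` (the cold-wall mean is within `C₁A₁/R⁴` of the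
  `R`-independent reference `p q β` on the window — a finite-size law for ONE Dirichlet cube, one-loop `≍ c/(βR⁴)`), and (b) the cold-wall-referenced split
  with tolerance `A₂` holding at every `(β, R)` of the window (`coldWallSplit_onset` form: onset `β_cw R ≤ β` whenever `β ≥ β₀`, `1 ≤ R`, `R·uRec β ≤ ℓ₁`).
  Conversely (split) ⇒ (DR) is tempered-d1's `dirichletRate_of_pureSplitCl`; so, modulo constants, **(split-cl) ⟺ (DR) ∧ (cold-wall split on the window)**.

HONEST READING.  §1's onset is ineffective (compactness); (b) with an effective `O(log R)` onset is the background-field expansion of the cube kernel around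
the classical minimiser RELATIVE to the cold wall — the genuine E0′-K content; (a) is the Dirichlet finite-size law of the plaquette mean.  Nothing here
asserts either; not E0′, not a gap claim, not Clay.  Folklore: Laplace on a compact fibre + triangle inequality.
-/

set_option autoImplicit false

noncomputable section

open MeasureTheory Filter Topology
open Literature.MathematicalPhysics.QuantumFieldTheory (LatticeRep)
open Literature.MathematicalPhysics.QuantumLattice (LGConfig fundamentalLatticeRep)
open Summit.QuantumFields.YangMills.Cruxes.OSLegsFromFemtoAndGap.DlrCollarTransfer

namespace Summit.QuantumFields.YangMills.Cruxes.UVSeamRec.ClassicalResponse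

/-! ## §1 The fixed-scale split referenced to the cold-wall kernel -/

section ColdWall

variable {G : Type} [Group G] [TopologicalSpace G] [IsTopologicalGroup G] [CompactSpace G]
  [MeasurableSpace G] [BorelSpace G] (r : LatticeRep G)

/-- **THE FIXED-SCALE SPLIT WITH THE COLD-WALL REFERENCE** (every compact `G`, every lattice representation).  For every cube radius `R ≥ 1`,
orientation `q`, site `x` and constants `C_s, C₁, A₀ > 0` there is an onset `β₁` such that for ALL `β ≥ β₁` and ALL exteriors `η`:
`(R⁴/C₁)·|kerE^η_β(plane q x) − kerE^{𝟙}_β(plane q x)| ≤ A₀ + carrierCl r C_s 1 β R q x η`.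
Proof: `t := A₀C₁/(2R⁴)`; on the closed low-response set `{classicalResponse₁ ≤ t/2}` — which contains the identity exterior (`classicalResponse_one`) —
`…Semiclassical.kerE_deficit_le_of_classicalResponse_le` bounds BOTH thermal deficits `kerE^η(N − plane)`, `kerE^𝟙(N − plane)` by `t + 2N·C·e^{−βΔ} ≤ 2t`,
so their difference is `≤ 2t`; off it the carrier `βR⁴(t/2)/C_s` exceeds the trivial bound `2N·R⁴/C₁`. [folklore] -/
theorem pureSplit_fixedScale_coldWall {R : ℕ} (hR : 1 ≤ R) (q : Fin 4 × Fin 4) (hq : q.1 < q.2) (x : Fin 4 → ℤ) {C_s C₁ A₀ : ℝ}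
    (hCs : 0 < C_s) (hC₁ : 0 < C₁) (hA₀ : 0 < A₀) :
    ∃ β₁ : ℝ, ∀ β : ℝ, β₁ ≤ β → ∀ η : LGConfig 4 G,
      (R : ℝ) ^ 4 / C₁ * |kerE G r β (fun k => x k - (R + 1)) (2 * R + 3) η (plane G r q x) -
          kerE G r β (fun k => x k - (R + 1)) (2 * R + 3) 1 (plane G r q x)| ≤
        A₀ + carrierCl r C_s 1 β R q x η := by
  have hR4 : (0 : ℝ) < (R : ℝ) ^ 4 := by positivity
  set t : ℝ := A₀ * C₁ / (2 * (R : ℝ) ^ 4) with htdef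
  have ht : 0 < t := by positivity
  have hδt : t / 2 < t := by linarith
  obtain ⟨C, Δ, hC, hΔ, hlow⟩ := kerE_deficit_le_of_classicalResponse_le r hR q x one_pos hδt ht.le
  obtain ⟨β_b, hβ_b⟩ : ∃ β_b : ℝ, ∀ β, β_b ≤ β → 2 * r.N * (C * Real.exp (-β * Δ)) ≤ t := by
    have hneg : Tendsto (fun β : ℝ => -β * Δ) atTop atBot := tendsto_neg_atTop_atBot.atBot_mul_const hΔ
    have hlim : Tendsto (fun β : ℝ => 2 * r.N * (C * Real.exp (-β * Δ))) atTop (𝓝 (2 * r.N * (C * 0))) :=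
      tendsto_const_nhds.mul (tendsto_const_nhds.mul (Real.tendsto_exp_atBot.comp hneg))
    rw [mul_zero, mul_zero] at hlim
    exact (hlim.eventually (Iic_mem_nhds ht)).exists_forall_of_atTop
  refine ⟨max (max β_b 0) (2 * r.N * C_s / (C₁ * (t / 2))), fun β hβ η => ?_⟩
  have hβb : β_b ≤ β := le_trans (le_trans (le_max_left _ _) (le_max_left _ _)) hβ
  have hβ0 : 0 ≤ β := le_trans (le_trans (le_max_right _ _) (le_max_left _ _)) hβ
  have hβa : 2 * r.N * C_s / (C₁ * (t / 2)) ≤ β := le_trans (le_max_right _ _) hβ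
  -- the two thermal deficits
  set d : ℝ := kerE G r β (fun k => x k - (R + 1)) (2 * R + 3) η (fun U => (r.N : ℝ) - plane G r q x U) with hddef
  set d₁ : ℝ := kerE G r β (fun k => x k - (R + 1)) (2 * R + 3) 1 (fun U => (r.N : ℝ) - plane G r q x U) with hd₁def
  obtain ⟨hd0, hd2⟩ := kerE_deficit_mem_Icc r β (fun k => x k - (R + 1)) (2 * R + 3) η q x
  obtain ⟨hd₁0, hd₁2⟩ := kerE_deficit_mem_Icc r β (fun k => x k - (R + 1)) (2 * R + 3) (1 : LGConfig 4 G) q x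
  have hdiff : kerE G r β (fun k => x k - (R + 1)) (2 * R + 3) η (plane G r q x) -
      kerE G r β (fun k => x k - (R + 1)) (2 * R + 3) 1 (plane G r q x) = d₁ - d := by
    rw [hddef, hd₁def, kerE_const_sub r β _ _ η (continuous_plane r q x), kerE_const_sub r β _ _ 1 (continuous_plane r q x)]
    ring
  rw [hdiff]
  have hcar0 : 0 ≤ carrierCl r C_s 1 β R q x η := carrierCl_nonneg hCs one_pos hβ0 R q x η
  -- the identity exterior is in the low-response set
  have hdepth : 2 ≤ depth (fun k => x k - (R + 1)) (2 * R + 3) x := by rw [depth_centred]; omega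
  have h1resp : classicalResponse r (fun k => x k - (R + 1)) (2 * R + 3) q x 1 (1 : LGConfig 4 G) ≤ t / 2 := by
    rw [classicalResponse_one q hq hdepth one_pos le_rfl]; positivity
  have hd₁small : d₁ ≤ 2 * t := by
    have h1 := hlow β hβ0 1 h1resp
    have h2 := hβ_b β hβb
    rw [hd₁def]; linarith
  by_cases hlowη : classicalResponse r (fun k => x k - (R + 1)) (2 * R + 3) q x 1 η ≤ t / 2
  · -- low response: both deficits in `[0, 2t]`
    have h1 := hlow β hβ0 η hlowη
    have h2 := hβ_b β hβb
    have h3 : d ≤ 2 * t := by rw [hddef]; linarith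
    have h4 : |d₁ - d| ≤ 2 * t := by
      rw [abs_le]; constructor <;> linarith
    have h5 : (R : ℝ) ^ 4 / C₁ * |d₁ - d| ≤ A₀ := by
      calc (R : ℝ) ^ 4 / C₁ * |d₁ - d| ≤ (R : ℝ) ^ 4 / C₁ * (2 * t) := by gcongr
        _ = A₀ := by rw [htdef]; field_simp
    linarith
  · -- high response: the carrier dominates the trivial bound `2N R⁴/C₁`
    push Not at hlowη
    have habs : |d₁ - d| ≤ 2 * r.N := by
      rw [abs_le]; constructor <;> linarith
    have h1 : (R : ℝ) ^ 4 / C₁ * |d₁ - d| ≤ (R : ℝ) ^ 4 / C₁ * (2 * r.N) := by gcongr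
    have h2 : 2 * r.N * C_s / (C₁ * (t / 2)) * ((R : ℝ) ^ 4 * (t / 2) / C_s) ≤ β * ((R : ℝ) ^ 4 * (t / 2) / C_s) :=
      mul_le_mul_of_nonneg_right hβa (by positivity)
    have h3 : 2 * r.N * C_s / (C₁ * (t / 2)) * ((R : ℝ) ^ 4 * (t / 2) / C_s) = (R : ℝ) ^ 4 / C₁ * (2 * r.N) := by
      field_simp
    have h4 : β * ((R : ℝ) ^ 4 * (t / 2) / C_s) ≤ carrierCl r C_s 1 β R q x η := by
      unfold carrierCl
      rw [show β * ((R : ℝ) ^ 4 * (t / 2) / C_s) = β * (R : ℝ) ^ 4 / C_s * (t / 2) by ring]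
      exact mul_le_mul_of_nonneg_left hlowη.le (by positivity)
    linarith

end ColdWall

/-! ## §2 (split-cl) from the Dirichlet rate law and the cold-wall-referenced split on the record's window -/

/-- **THE LOCATED DECOMPOSITION OF (split-cl)** (`SU(2)`, fundamental representation, unit of record).  If
(a) tempered-d1's Dirichlet rate law `DirichletRate C₁ A₁ β₀ ℓ₁ p` holds (the cold-wall centre-plane mean is within `C₁A₁/R⁴` of the reference `p q β` on the
window), and (b) the COLD-WALL-REFERENCED split holds on the window with tolerance `A₂` — for `β ≥ β₀`, `1 ≤ R`, `R·uRec β ≤ ℓ₁`, every `q.1 < q.2`, `x`, `η`: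
`(R⁴/C₁)|kerE^η(plane q x) − kerE^{𝟙}(plane q x)| ≤ A₂ + carrierCl rF C_s 1 β R q x η` — then `PureSplitCl C_s C₁ (A₁ + A₂) β₀ ℓ₁ p` (triangle inequality).
With tempered-d1's converse `dirichletRate_of_pureSplitCl`: (split-cl) ⟺ (DR) ∧ (cold-wall split on the window), up to the tolerances. [folklore] -/
theorem pureSplitCl_of_dirichletRate_and_coldWallSplit {C_s C₁ A₁ A₂ β₀ ℓ₁ : ℝ} {p : Fin 4 × Fin 4 → ℝ → ℝ} (hC₁ : 0 < C₁)
    (hDR : DirichletRate C₁ A₁ β₀ ℓ₁ p)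
    (hCW : ∀ β : ℝ, β₀ ≤ β → ∀ R : ℕ, 1 ≤ R → (R : ℝ) * Transport.uRec β ≤ ℓ₁ →
      ∀ (q : Fin 4 × Fin 4) (x : Fin 4 → ℤ), q.1 < q.2 → ∀ η : LGConfig 4 (Matrix.specialUnitaryGroup (Fin 2) ℂ),
      (R : ℝ) ^ 4 / C₁ * |kerE (Matrix.specialUnitaryGroup (Fin 2) ℂ) (fundamentalLatticeRep 2) β (fun k => x k - (R + 1)) (2 * R + 3) η
          (plane (Matrix.specialUnitaryGroup (Fin 2) ℂ) (fundamentalLatticeRep 2) q x) -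
        kerE (Matrix.specialUnitaryGroup (Fin 2) ℂ) (fundamentalLatticeRep 2) β (fun k => x k - (R + 1)) (2 * R + 3) 1
          (plane (Matrix.specialUnitaryGroup (Fin 2) ℂ) (fundamentalLatticeRep 2) q x)| ≤
        A₂ + carrierCl (fundamentalLatticeRep 2) C_s 1 β R q x η) :
    PureSplitCl C_s C₁ (A₁ + A₂) β₀ ℓ₁ p := by
  intro β hβ R hR hRu q x hq η
  have h1 := hDR β hβ R hR hRu q x hq
  have h2 := hCW β hβ R hR hRu q x hq η
  have hR4 : (0 : ℝ) ≤ (R : ℝ) ^ 4 / C₁ := by positivity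
  set kη : ℝ := kerE (Matrix.specialUnitaryGroup (Fin 2) ℂ) (fundamentalLatticeRep 2) β (fun k => x k - (R + 1)) (2 * R + 3) η
    (plane (Matrix.specialUnitaryGroup (Fin 2) ℂ) (fundamentalLatticeRep 2) q x) with hkη
  set k₁ : ℝ := kerE (Matrix.specialUnitaryGroup (Fin 2) ℂ) (fundamentalLatticeRep 2) β (fun k => x k - (R + 1)) (2 * R + 3) 1
    (plane (Matrix.specialUnitaryGroup (Fin 2) ℂ) (fundamentalLatticeRep 2) q x) with hk₁
  have htri : |kη - p q β| ≤ |kη - k₁| + |k₁ - p q β| := abs_sub_le _ _ _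
  have h3 : (R : ℝ) ^ 4 / C₁ * |kη - p q β| ≤ (R : ℝ) ^ 4 / C₁ * |kη - k₁| + (R : ℝ) ^ 4 / C₁ * |k₁ - p q β| := by
    rw [← mul_add]; exact mul_le_mul_of_nonneg_left htri hR4
  linarith

/-- **The same with an ONSET FUNCTION**: if the cold-wall-referenced split holds at each scale `R ≥ 1` for `β ≥ β_cw R` (e.g. §1, ineffective) and the onset
is dominated by the record's window (`β ≥ β₀ ∧ 1 ≤ R ∧ R·uRec β ≤ ℓ₁ ⇒ β_cw R ≤ β`, i.e. `β_cw(R) ≲ 4b₀ log R`), then with (DR) the flag-free split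
`PureSplitCl C_s C₁ (A₁ + A₂) β₀ ℓ₁ p` holds.  The effective logarithmic onset of the COLD-WALL split is the renormalisation-group content of (split-cl);
the `Θ(1/β)` thermal offsets that obstruct the trivial reference (`ThermalFloor.onset_ge_of_split_const_at`) cancel here. [folklore] -/
theorem pureSplitCl_of_dirichletRate_and_coldWallOnset {C_s C₁ A₁ A₂ β₀ ℓ₁ : ℝ} {p : Fin 4 × Fin 4 → ℝ → ℝ} (hC₁ : 0 < C₁)
    (hDR : DirichletRate C₁ A₁ β₀ ℓ₁ p) (β_cw : ℕ → ℝ)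
    (hCW : ∀ R : ℕ, 1 ≤ R → ∀ β : ℝ, β_cw R ≤ β →
      ∀ (q : Fin 4 × Fin 4) (x : Fin 4 → ℤ), q.1 < q.2 → ∀ η : LGConfig 4 (Matrix.specialUnitaryGroup (Fin 2) ℂ),
      (R : ℝ) ^ 4 / C₁ * |kerE (Matrix.specialUnitaryGroup (Fin 2) ℂ) (fundamentalLatticeRep 2) β (fun k => x k - (R + 1)) (2 * R + 3) η
          (plane (Matrix.specialUnitaryGroup (Fin 2) ℂ) (fundamentalLatticeRep 2) q x) -
        kerE (Matrix.specialUnitaryGroup (Fin 2) ℂ) (fundamentalLatticeRep 2) β (fun k => x k - (R + 1)) (2 * R + 3) 1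
          (plane (Matrix.specialUnitaryGroup (Fin 2) ℂ) (fundamentalLatticeRep 2) q x)| ≤
        A₂ + carrierCl (fundamentalLatticeRep 2) C_s 1 β R q x η)
    (honset : ∀ β : ℝ, β₀ ≤ β → ∀ R : ℕ, 1 ≤ R → (R : ℝ) * Transport.uRec β ≤ ℓ₁ → β_cw R ≤ β) :
    PureSplitCl C_s C₁ (A₁ + A₂) β₀ ℓ₁ p :=
  pureSplitCl_of_dirichletRate_and_coldWallSplit hC₁ hDR
    fun β hβ R hR hRu q x hq η => hCW R hR β (honset β hβ R hR hRu) q x hq η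

end Summit.QuantumFields.YangMills.Cruxes.UVSeamRec.ClassicalResponse

end
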